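import Literature.NumberTheory.Automorphic.FLSResidualImageCriteria
import HarnessLib

/-!
# Freitas–Le Hung–Siksek 2015, Proposition 3.1 (ii) (= published Prop. 4.1 (ii)): an elliptic
# curve whose mod-`p` image is absolutely reducible on `G_{K(ζ_p)}` has image in a Borel subgroup
# or in the normaliser of a Cartan subgroup (PROVED, every odd `p`)

Topic `Literature/NumberTheory/Automorphic`; a theorems-only companion of
`FLSResidualImageCriteria.lean` (Prop. 9.1 (a) proved, 9.1 (c) as a fact with `_holds`),
`TotallyRealModularityLargeImage.lean` (Prop. 4.1 (i) proved:
`range_restrictField_cyclotomic_eq_of_isTorsionGaloisRep`) and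
`TotallyRealModularityQuarticSixteenCurves.lean` (`Box2022.clause_five`, the case `p = 5` combined
with FLS Thm. 3).  The group theory is Caraiani–Newton's Lemma 7.1.1 (1) as PROVED in the tree
(`CaraianiNewton.exists_le_normalizer_cartan`, file `CartanNormalizerCriterionGL2Fp.lean`, whose
docstring notes that the source "proved [it] by appeal to [FLHS15, Lemma 2.2]" = Lemma 3.2 of the
arXiv text); this file supplies the printed ELLIPTIC-CURVE statement, for every odd prime `p` and
every field of characteristic `0` (the source: `K` totally real, `p ≥ 3`).  No definition, no
named fact.  Typed for the cell `pub/lg-quartmod` (F-L1), which needs the `p = 5` image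
trichotomy `{b5, s5, ns5}` over quartic fields containing `√5` in more than one guise.

## What the source prints (held text `paper:arxiv-1310.7088`, p. 10; published numbering 4.1/4.2)

N. Freitas, B. V. Le Hung, S. Siksek, *Elliptic curves over real quadratic fields are modular*,
Invent. Math. 201 (2015) 159–206 [FreitasLeHungSiksek2015]:

> **Proposition 3.1.** Let `E` be an elliptic curve over a totally real field `K`. Let `p ≥ 3` be
> a rational prime, and write `ρ̄ = ρ̄_{E,p}`. Then (i) `ρ̄(G_{K(ζ_p)}) = ρ̄(G_K) ∩ SL₂(𝔽_p)`.
> (ii) If `ρ̄(G_{K(ζ_p)})` is absolutely reducible, then `ρ̄(G_K)` is contained either in a Borel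
> subgroup, or in the normalizer of a Cartan subgroup. In this case `E` gives rise to a
> non-cuspidal `K`-point on `X(b p)`, `X(s p)` or `X(ns p)`.
> *Proof.* The determinant of `ρ̄` is the mod `p` cyclotomic character […] The first part follows
> immediately. Write `G = ρ̄(G_K)`, and suppose `G` is not contained in a Borel subgroup. Then `G`
> is irreducible, and as `K` is totally real it is absolutely irreducible. The second part follows
> from Lemma 3.2 below.
> **Lemma 3.2.** Let `p ≥ 3` be prime. Let `G` be an absolutely irreducible subgroup of `GL₂(𝔽_p)`
> such that `G ∩ SL₂(𝔽_p)` is absolutely reducible. Then `G` is contained in the normalizer of a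
> Cartan subgroup. […]

## Rendering

* `E / K`, `ρ̄ = ρ̄_{E,p}` ⟶ a Weierstrass curve `W / K` with `W.IsElliptic` and a framing
  `ρ̄ : Γ_K →ₜ* GL₂(𝔽_p)` of the Galois action on the geometric `p`-torsion
  (`WeierstrassCurve.IsTorsionGaloisRep`), as in all sibling files; `K` any field of
  characteristic `0` (total reality is used in the source only to pass from "irreducible" to
  "absolutely irreducible", a step the tree's Lemma 7.1.1 (1) does not need: its hypothesis is
  plain irreducibility of `G` plus absolute reducibility of the determinant-one part).
* "`ρ̄(G_{K(ζ_p)})` absolutely reducible" ⟶ for some model `L` of `K(ζ_p)`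
  (`IsCyclotomicExtension {p} K L`), `¬ FramedRep.IsAbsolutelyIrreducible (ρ̄.restrictField L)` —
  the negation of one instance of the carrier `ModPImageAbsIrreducibleOverCyclotomic` of
  `FLS2015_theorem3/4`.
* "contained in a Borel subgroup" ⟶ `ρ̄` is reducible (`¬ FramedRep.IsIrreducible ρ̄`; then a
  conjugate framing is upper triangular, `FLS2015.exists_isTorsionGaloisRep_borel_of_not_isIrreducible`);
  "in the normalizer of a Cartan subgroup" ⟶ `ρ̄(Γ_K) ≤ N(C)` for some
  `C ∈ Serre1972.cartanSubgroups (ZMod p)` (split `P (* 0; 0 *) P⁻¹` or non-split `kˣ`, Serre 1972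
  §2.1 as vendored in `SerreCartanSubgroupsGL2Fp.lean`).
* "`E` gives rise to a non-cuspidal `K`-point on `X(b p)`, `X(s p)` or `X(ns p)`" is the moduli
  interpretation of these three level structures (no carrier for modular curves as curves in the
  tree; not restated).

## References

* [FreitasLeHungSiksek2015] Invent. Math. 201 (2015) 159–206 = arXiv:1310.7088, Prop. 3.1 and
  Lemma 3.2 (held text p. 10; published Prop. 4.1, Lemma 4.2).
* [CaraianiNewton2023] A. Caraiani, J. Newton, arXiv:2301.10509, Lemma 7.1.1 (1) (tree:
  `CaraianiNewton.exists_le_normalizer_cartan`); [Serre1972] §2.1.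
-/

open scoped NumberField MatrixGroups
open NumberField Field Matrix Literature.NumberTheory.GaloisRepresentations

noncomputable section

namespace Literature.NumberTheory.Automorphic

namespace FLS2015

universe u v

/-- **Freitas–Le Hung–Siksek 2015, Proposition 3.1 (ii), first sentence — PROVED for every odd
prime `p`.**  Let `W / K` be an elliptic curve over a field of characteristic `0`, `p` an odd
prime, `ρ̄` a framing of the Galois action on `W[p]`, and `L` a model of `K(ζ_p)` such that
`ρ̄|_{Γ_L}` is not absolutely irreducible ("`ρ̄(G_{K(ζ_p)})` is absolutely reducible").  Then either
`ρ̄` is reducible ("contained in a Borel subgroup"), or its image `ρ̄(Γ_K)` lies in the normaliser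
of a Cartan subgroup of `GL₂(𝔽_p)` (split or non-split, `Serre1972.cartanSubgroups`).  Proof: if
`ρ̄` is irreducible its image fixes no line (`FLS2015.range_irreducible`); since `det ρ̄ = χ̄_p`
(`WeierstrassCurve.det_eq_modPCyclotomicCharacter_of_isTorsionGaloisRep_holds`) the determinant-one
elements of the image are values on `Γ_L` (Prop. 3.1 (i)), so they have a common eigenvector over
an extension of `𝔽_p` (`exists_eigenvector_of_det_eq_one_of_not_isAbsolutelyIrreducible_restrictField`);
Lemma 3.2, in the tree's proved form `CaraianiNewton.exists_le_normalizer_cartan` (`p ≠ 2`),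
concludes. [cite: FreitasLeHungSiksek2015, Prop. 3.1 (ii) and Lemma 3.2 (p. 10 of arXiv:1310.7088)] -/
theorem prop3_1_ii {K : Type u} [Field K] [CharZero K] (W : WeierstrassCurve K) [W.IsElliptic]
    {p : ℕ} [Fact p.Prime] (hp : p ≠ 2) {ρ : ModPGaloisRep K (ZMod p) 2}
    (hρ : W.IsTorsionGaloisRep p ρ) (L : Type v) [Field L] [Algebra K L]
    [IsCyclotomicExtension {p} K L]
    (hred : ¬ FramedRep.IsAbsolutelyIrreducible (FramedGaloisRep.restrictField L ρ)) :
    ¬ FramedRep.IsIrreducible ρ ∨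
      ∃ C ∈ Serre1972.cartanSubgroups (ZMod p),
        ρ.toMonoidHom.range ≤ Subgroup.normalizer (C : Set (GL (Fin 2) (ZMod p))) := by
  by_cases hirr : FramedRep.IsIrreducible ρ
  swap
  · exact Or.inl hirr
  refine Or.inr ?_
  haveI : NeZero ((p : ℕ) : K) := NeZero.charZero
  have hdet : ∀ σ, Matrix.GeneralLinearGroup.det (ρ σ) = modPCyclotomicCharacterZMod K p σ :=
    W.det_eq_modPCyclotomicCharacter_of_isTorsionGaloisRep_holds p ρ hρ
  obtain ⟨B, _, f, v, hv, hB⟩ :=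
    exists_eigenvector_of_det_eq_one_of_not_isAbsolutelyIrreducible_restrictField ρ hdet L hred
  set G : Subgroup (GL (Fin 2) (ZMod p)) := ρ.toMonoidHom.range with hG
  have hirr' : ∀ (w : Fin 2 → ZMod p) (hw : w ≠ 0), ¬ G ≤ eigenvectorStabilizer w hw := by
    intro w hw hle
    obtain ⟨g, hg, hne⟩ := range_irreducible ρ hirr w hw
    obtain ⟨a, ha⟩ := mem_eigenvectorStabilizer_iff.mp (hle hg)
    exact hne a ha
  have hred' : ∃ (L' : Type) (_ : Field L') (f' : ZMod p →+* L') (v' : Fin 2 → L'), v' ≠ 0 ∧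
      ∀ g ∈ G, Matrix.GeneralLinearGroup.det g = 1 →
        ∃ c : L', ((g : Matrix (Fin 2) (Fin 2) (ZMod p)).map f') *ᵥ v' = c • v' := by
    refine ⟨B, inferInstance, f, v, hv, ?_⟩
    rintro _ ⟨σ, rfl⟩ hσ
    exact hB σ hσ
  obtain ⟨C, hC, hGC⟩ := CaraianiNewton.exists_le_normalizer_cartan.{0} hp G hirr' hred'
  exact ⟨C, hC, hGC⟩

/-- **Prop. 3.1 (ii) with the level structures spelled out on framings** ("`E` gives rise to a
non-cuspidal `K`-point on `X(b p)`, `X(s p)` or `X(ns p)`"): under the hypotheses of `prop3_1_ii`,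
SOME framing `ρ̄'` of `W[p]` is upper triangular (entry `(1,0)` zero — `X(b p)`), or takes values in
the normaliser of a split Cartan subgroup `P (* 0; 0 *) P⁻¹` (`X(s p)`), or in the normaliser of a
non-split Cartan subgroup `kˣ`, `k ⊆ M₂(𝔽_p)` a field of degree `2` (`X(ns p)`).  (A reducible
framing is conjugated into the Borel by `FLS2015.exists_isTorsionGaloisRep_borel_of_not_isIrreducible`;
in the Cartan case the given framing serves.) [cite: FreitasLeHungSiksek2015, Prop. 3.1 (ii) (p. 10 of arXiv:1310.7088)] -/
theorem prop3_1_ii_levelStructure {K : Type u} [Field K] [CharZero K] (W : WeierstrassCurve K)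
    [W.IsElliptic] {p : ℕ} [Fact p.Prime] (hp : p ≠ 2) {ρ : ModPGaloisRep K (ZMod p) 2}
    (hρ : W.IsTorsionGaloisRep p ρ) (L : Type v) [Field L] [Algebra K L]
    [IsCyclotomicExtension {p} K L]
    (hred : ¬ FramedRep.IsAbsolutelyIrreducible (FramedGaloisRep.restrictField L ρ)) :
    ∃ ρ' : FramedGaloisRep K (ZMod p) 2, W.IsTorsionGaloisRep p ρ' ∧
      ((∀ σ : absoluteGaloisGroup K,
          ((ρ' σ : GL (Fin 2) (ZMod p)) : Matrix (Fin 2) (Fin 2) (ZMod p)) 1 0 = 0) ∨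
        (∃ P : GL (Fin 2) (ZMod p), ∀ σ : absoluteGaloisGroup K,
          ρ' σ ∈ Subgroup.normalizer (Serre1972.splitCartan P : Set (GL (Fin 2) (ZMod p)))) ∨
        (∃ k : Subalgebra (ZMod p) (Matrix (Fin 2) (Fin 2) (ZMod p)),
          IsField k ∧ Module.finrank (ZMod p) k = 2 ∧ ∀ σ : absoluteGaloisGroup K,
            ρ' σ ∈ Subgroup.normalizer (Serre1972.unitGroup k : Set (GL (Fin 2) (ZMod p))))) := by
  rcases prop3_1_ii W hp hρ L hred with hnirr | ⟨C, hC, hGC⟩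
  · obtain ⟨ρ', hρ', hB⟩ := exists_isTorsionGaloisRep_borel_of_not_isIrreducible hρ hnirr
    exact ⟨ρ', hρ', Or.inl hB⟩
  · have hmem : ∀ σ : absoluteGaloisGroup K,
        ρ σ ∈ Subgroup.normalizer (C : Set (GL (Fin 2) (ZMod p))) := fun σ => hGC ⟨σ, rfl⟩
    refine ⟨ρ, hρ, Or.inr ?_⟩
    rcases hC with ⟨P, rfl⟩ | ⟨k, hk, hk2, rfl⟩
    · exact Or.inl ⟨P, hmem⟩
    · exact Or.inr ⟨k, hk, hk2, hmem⟩

/-- **The contrapositive used with Theorems 3–4** (source, §1 p. 5: a curve escaping Thms. 3–4 "has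
small image" at `p`): for an integral model `E / 𝓞 K` (`K` a number field, `Δ(E) ≠ 0`) and an odd
prime `p`, if `ρ̄_{E,p}(G_{K(ζ_p)})` is NOT absolutely irreducible in the sense of the carrier
`ModPImageAbsIrreducibleOverCyclotomic` (some framing, some model of `K(ζ_p)`), then some framing of
`E[p]` is Borel, split-Cartan-normaliser or non-split-Cartan-normaliser valued.
[cite: FreitasLeHungSiksek2015, Prop. 3.1 (ii) (p. 10 of arXiv:1310.7088)] -/
theorem levelStructure_of_not_modPImageAbsIrreducibleOverCyclotomic {K : Type} [Field K]
    [NumberField K] (E : WeierstrassCurve (𝓞 K)) (hΔ : E.Δ ≠ 0) {p : ℕ} [Fact p.Prime]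
    (hp : p ≠ 2) (h : ¬ ModPImageAbsIrreducibleOverCyclotomic (E.baseChange K) p) :
    ∃ ρ' : FramedGaloisRep K (ZMod p) 2, (E.baseChange K).IsTorsionGaloisRep p ρ' ∧
      ((∀ σ : absoluteGaloisGroup K,
          ((ρ' σ : GL (Fin 2) (ZMod p)) : Matrix (Fin 2) (Fin 2) (ZMod p)) 1 0 = 0) ∨
        (∃ P : GL (Fin 2) (ZMod p), ∀ σ : absoluteGaloisGroup K,
          ρ' σ ∈ Subgroup.normalizer (Serre1972.splitCartan P : Set (GL (Fin 2) (ZMod p)))) ∨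
        (∃ k : Subalgebra (ZMod p) (Matrix (Fin 2) (Fin 2) (ZMod p)),
          IsField k ∧ Module.finrank (ZMod p) k = 2 ∧ ∀ σ : absoluteGaloisGroup K,
            ρ' σ ∈ Subgroup.normalizer (Serre1972.unitGroup k : Set (GL (Fin 2) (ZMod p))))) := by
  haveI := isElliptic_baseChange hΔ
  obtain ⟨ρ, hρ, L, _, _, _, hred⟩ :
      ∃ ρ : ModPGaloisRep K (ZMod p) 2, (E.baseChange K).IsTorsionGaloisRep p ρ ∧
        ∃ (L : Type) (_ : Field L) (_ : Algebra K L) (_ : IsCyclotomicExtension {p} K L),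
          ¬ FramedRep.IsAbsolutelyIrreducible (FramedGaloisRep.restrictField L ρ) := by
    by_contra hall
    push Not at hall
    exact h fun ρ hρ L _ _ _ => hall ρ hρ L inferInstance inferInstance inferInstance
  exact prop3_1_ii_levelStructure (E.baseChange K) hp hρ L hred

end FLS2015

end Literature.NumberTheory.Automorphic

end
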